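import Mathlib
import HarnessLib

/-!
# HANDOFF — DEFINITIONS for the gain side of the dodger: the edge profile `Φ(x) = Σ x^n/(n!(2n)!)` and the collar integral `I₀(Y) = ∫_0^Y Φ(u²)Φ((Y−u)²)du` (rh-explicit, track «HANDOFF», seat prove-2 gen9, ATTEMPT-16 §1 / §5; ATTEMPT-18 §2)

HONEST FRAMING. Nothing here bears on the truth of RH. These are the two special functions of ATTEMPT-16 §1 (HOME/handoff/prove-2/):
the near-edge profile of the dodger is `φ(σ) ≈ Φ(p₁σ²)` (Lemma D1) and its collar at lag `L − 2δ` is `≈ p₁^{−1/2}·I₀(2y)` (Lemma D2);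
the wall-ceiling rate `δ = y/√p₁` is fixed by the crossing `I₀(1.96y) ≥ M_q` (§6). This file DEFINES `dodgerPhi = Φ` and `dodgerI0 = I₀`
(needed as tree objects by Lemmas D1–D3 and the assembly) and proves their elementary API: summability (`summable_dodgerPhi_term`,
`hasSum_dodgerPhi`), `Φ(0) = 1`, `Φ ≥ 1` and the single-term minorant `x^n/(n!(2n)!) ≤ Φ(x)` on `x ≥ 0`, monotonicity of `Φ` on `[0, ∞)`,
continuity (Weierstrass M-test on `[−R, R]`), and for `I₀`: non-negativity and monotonicity in `Y`. No `sorry`, standard axioms.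

References: this track (ATTEMPT-16 §1, §5). Folklore (`Φ` is the `₀F₂(;1/2,1;x/4)`-type entire function; no property beyond the
series is used).
-/

set_option linter.dupNamespace false

noncomputable section

open Real Set MeasureTheory Filter
open scoped Topology

namespace Summit.RiemannHypothesis.RiemannHypothesis.Theorems.Handoff

/-- The `n`-th term of the profile series: `x^n/(n!·(2n)!)`. [this track, ATTEMPT-16 §1] -/
def dodgerPhiTerm (n : ℕ) (x : ℝ) : ℝ := x ^ n / ((n.factorial : ℝ) * ((2 * n).factorial : ℝ))

/-- **The edge profile** `Φ(x) := Σ_{n ≥ 0} x^n/(n!(2n)!)` (ATTEMPT-16 §1; `Φ(0) = 1`, increasing on `[0, ∞)`).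
[this track, ATTEMPT-16 §1] -/
def dodgerPhi (x : ℝ) : ℝ := ∑' n : ℕ, dodgerPhiTerm n x

/-- **The collar integral** `I₀(Y) := ∫_0^Y Φ(u²)Φ((Y − u)²)du` (ATTEMPT-16 §1; gen7's `I(y) = I₀(2y)`). [this track, ATTEMPT-16 §1] -/
def dodgerI0 (Y : ℝ) : ℝ := ∫ u in (0 : ℝ)..Y, dodgerPhi (u ^ 2) * dodgerPhi ((Y - u) ^ 2)

/-! ## Summability and the value at `0` -/

/-- `|x^n/(n!(2n)!)| ≤ |x|^n/n!`. [folklore] -/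
theorem abs_dodgerPhiTerm_le (n : ℕ) (x : ℝ) : |dodgerPhiTerm n x| ≤ |x| ^ n / (n.factorial : ℝ) := by
  unfold dodgerPhiTerm
  rw [abs_div, abs_pow, abs_of_pos (by positivity : (0 : ℝ) < (n.factorial : ℝ) * ((2 * n).factorial : ℝ))]
  refine div_le_div_of_nonneg_left (by positivity) (by positivity) ?_
  have h1 : (1 : ℝ) ≤ ((2 * n).factorial : ℝ) := by exact_mod_cast Nat.one_le_iff_ne_zero.2 (Nat.factorial_ne_zero _)
  have h0 : (0 : ℝ) ≤ (n.factorial : ℝ) := by positivity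
  nlinarith

/-- The profile series converges absolutely at every real `x`. [folklore] -/
theorem summable_dodgerPhiTerm (x : ℝ) : Summable fun n : ℕ => dodgerPhiTerm n x := by
  refine Summable.of_norm_bounded (Real.summable_pow_div_factorial |x|) fun n => ?_
  rw [Real.norm_eq_abs]
  exact abs_dodgerPhiTerm_le n x

/-- `Φ(x) = Σ_n x^n/(n!(2n)!)` as a `HasSum`. [this track, ATTEMPT-16 §1] -/
theorem hasSum_dodgerPhi (x : ℝ) : HasSum (fun n : ℕ => dodgerPhiTerm n x) (dodgerPhi x) :=
  (summable_dodgerPhiTerm x).hasSum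

/-- `Φ(0) = 1`. [this track, ATTEMPT-16 §1] -/
theorem dodgerPhi_zero : dodgerPhi 0 = 1 := by
  unfold dodgerPhi
  rw [tsum_eq_single 0 fun n hn => by simp [dodgerPhiTerm, zero_pow hn]]
  simp [dodgerPhiTerm]

/-! ## Positivity, the single-term minorant, monotonicity -/

/-- The terms are non-negative for `x ≥ 0`. [folklore] -/
theorem dodgerPhiTerm_nonneg (n : ℕ) {x : ℝ} (hx : 0 ≤ x) : 0 ≤ dodgerPhiTerm n x := by
  unfold dodgerPhiTerm; positivity

/-- **Single-term minorant**: `x^n/(n!(2n)!) ≤ Φ(x)` for `x ≥ 0`. [this track, ATTEMPT-16 §5] -/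
theorem dodgerPhiTerm_le_dodgerPhi (n : ℕ) {x : ℝ} (hx : 0 ≤ x) : dodgerPhiTerm n x ≤ dodgerPhi x :=
  (summable_dodgerPhiTerm x).le_tsum n fun m _ => dodgerPhiTerm_nonneg m hx

/-- `Φ(x) ≥ 1` for `x ≥ 0`. [this track, ATTEMPT-16 §1] -/
theorem one_le_dodgerPhi {x : ℝ} (hx : 0 ≤ x) : 1 ≤ dodgerPhi x := by
  have := dodgerPhiTerm_le_dodgerPhi 0 hx
  simpa [dodgerPhiTerm] using this

/-- `Φ(x) > 0` for `x ≥ 0`. [folklore] -/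
theorem dodgerPhi_pos {x : ℝ} (hx : 0 ≤ x) : 0 < dodgerPhi x := lt_of_lt_of_le one_pos (one_le_dodgerPhi hx)

/-- `Φ` is non-decreasing on `[0, ∞)` (termwise). [this track, ATTEMPT-16 §1] -/
theorem dodgerPhi_monotoneOn : MonotoneOn dodgerPhi (Ici 0) := by
  intro x hx y _ hxy
  refine (summable_dodgerPhiTerm x).tsum_le_tsum (fun n => ?_) (summable_dodgerPhiTerm y)
  unfold dodgerPhiTerm
  exact div_le_div_of_nonneg_right (pow_le_pow_left₀ hx hxy n) (by positivity)

/-- `Φ(x) ≤ Φ(y)` for `0 ≤ x ≤ y`. [folklore] -/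
theorem dodgerPhi_le_dodgerPhi {x y : ℝ} (hx : 0 ≤ x) (hxy : x ≤ y) : dodgerPhi x ≤ dodgerPhi y :=
  dodgerPhi_monotoneOn (mem_Ici.2 hx) (mem_Ici.2 (hx.trans hxy)) hxy

/-! ## Continuity -/

/-- `Φ` is continuous on every `[−R, R]` (Weierstrass M-test with `R^n/n!`), hence continuous. [folklore] -/
theorem continuous_dodgerPhi : Continuous dodgerPhi := by
  rw [continuous_iff_continuousAt]
  intro x
  set R : ℝ := |x| + 1 with hR
  have hcont : ContinuousOn dodgerPhi (Icc (-R) R) := by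
    unfold dodgerPhi
    refine continuousOn_tsum (fun n => ?_) (Real.summable_pow_div_factorial R) fun n y hy => ?_
    · unfold dodgerPhiTerm; fun_prop
    · rw [Real.norm_eq_abs]
      refine (abs_dodgerPhiTerm_le n y).trans ?_
      exact div_le_div_of_nonneg_right (pow_le_pow_left₀ (abs_nonneg y) (abs_le.2 hy) n) (by positivity)
  exact hcont.continuousAt (Icc_mem_nhds (by rw [hR]; linarith [neg_abs_le x]) (by rw [hR]; linarith [le_abs_self x]))

/-! ## The collar integral -/

/-- The integrand of `I₀` is continuous. [folklore] -/
theorem continuous_dodgerI0_integrand (Y : ℝ) :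
    Continuous fun u : ℝ => dodgerPhi (u ^ 2) * dodgerPhi ((Y - u) ^ 2) :=
  (continuous_dodgerPhi.comp (continuous_pow 2)).mul
    (continuous_dodgerPhi.comp ((continuous_const.sub continuous_id).pow 2))

/-- `I₀(Y) ≥ 0` for `Y ≥ 0`. [this track, ATTEMPT-16 §1] -/
theorem dodgerI0_nonneg {Y : ℝ} (hY : 0 ≤ Y) : 0 ≤ dodgerI0 Y := by
  unfold dodgerI0
  refine intervalIntegral.integral_nonneg hY fun u _ => ?_
  exact mul_nonneg (dodgerPhi_pos (sq_nonneg _)).le (dodgerPhi_pos (sq_nonneg _)).le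

/-- **`I₀` is non-decreasing on `[0, ∞)`**: for `0 ≤ Y ≤ Y'`, the integrand on `[0, Y]` grows with `Y'` (`Φ` increasing,
`(Y' − u)² ≥ (Y − u)²` for `u ≤ Y`) and the extra piece `[Y, Y']` is non-negative. [this track, ATTEMPT-16 §5] -/
theorem dodgerI0_monotoneOn : MonotoneOn dodgerI0 (Ici 0) := by
  intro Y hY Y' hY' hYY'
  have hY0 : (0 : ℝ) ≤ Y := hY
  unfold dodgerI0
  have hi : ∀ a b : ℝ, IntervalIntegrable (fun u : ℝ => dodgerPhi (u ^ 2) * dodgerPhi ((Y' - u) ^ 2)) volume a b :=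
    fun a b => (continuous_dodgerI0_integrand Y').intervalIntegrable a b
  rw [← intervalIntegral.integral_add_adjacent_intervals (hi 0 Y) (hi Y Y')]
  have h1 : ∫ u in (0 : ℝ)..Y, dodgerPhi (u ^ 2) * dodgerPhi ((Y - u) ^ 2) ≤
      ∫ u in (0 : ℝ)..Y, dodgerPhi (u ^ 2) * dodgerPhi ((Y' - u) ^ 2) := by
    refine intervalIntegral.integral_mono_on hY0 ((continuous_dodgerI0_integrand Y).intervalIntegrable 0 Y) (hi 0 Y)
      fun u hu => ?_
    refine mul_le_mul_of_nonneg_left ?_ (dodgerPhi_pos (sq_nonneg _)).le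
    exact dodgerPhi_le_dodgerPhi (sq_nonneg _) (pow_le_pow_left₀ (by linarith [hu.2]) (by linarith) 2)
  have h2 : 0 ≤ ∫ u in Y..Y', dodgerPhi (u ^ 2) * dodgerPhi ((Y' - u) ^ 2) :=
    intervalIntegral.integral_nonneg hYY' fun u _ =>
      mul_nonneg (dodgerPhi_pos (sq_nonneg _)).le (dodgerPhi_pos (sq_nonneg _)).le
  linarith

/-- **Single-term minorant of the collar integral**: for `Y ≥ 0` and any `n`,
`I₀(Y) ≥ (Y/2)·(((Y/4)²)^n/(n!(2n)!))²` — on the middle half `[Y/4, 3Y/4]` both arguments are `≥ (Y/4)²`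
(a Stirling-free form of ATTEMPT-16 Lemma D3, enough under ATTEMPT-18 (D-1)). [this track, ATTEMPT-18 §2] -/
theorem dodgerI0_ge_single_term {Y : ℝ} (hY : 0 ≤ Y) (n : ℕ) :
    Y / 2 * (dodgerPhiTerm n ((Y / 4) ^ 2)) ^ 2 ≤ dodgerI0 Y := by
  unfold dodgerI0
  have hi : ∀ a b : ℝ, IntervalIntegrable (fun u : ℝ => dodgerPhi (u ^ 2) * dodgerPhi ((Y - u) ^ 2)) volume a b :=
    fun a b => (continuous_dodgerI0_integrand Y).intervalIntegrable a b
  have hnn : ∀ a b : ℝ, a ≤ b → 0 ≤ ∫ u in a..b, dodgerPhi (u ^ 2) * dodgerPhi ((Y - u) ^ 2) := fun a b hab =>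
    intervalIntegral.integral_nonneg hab fun u _ =>
      mul_nonneg (dodgerPhi_pos (sq_nonneg _)).le (dodgerPhi_pos (sq_nonneg _)).le
  rw [← intervalIntegral.integral_add_adjacent_intervals (hi 0 (Y / 4)) (hi (Y / 4) Y),
    ← intervalIntegral.integral_add_adjacent_intervals (hi (Y / 4) (3 * Y / 4)) (hi (3 * Y / 4) Y)]
  have h0 := hnn 0 (Y / 4) (by linarith)
  have h3 := hnn (3 * Y / 4) Y (by linarith)
  -- the middle half
  set c : ℝ := dodgerPhiTerm n ((Y / 4) ^ 2) with hc
  have hc0 : 0 ≤ c := dodgerPhiTerm_nonneg n (sq_nonneg _)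
  have hmid : ∫ u in (Y / 4)..(3 * Y / 4), c ^ 2 ≤ ∫ u in (Y / 4)..(3 * Y / 4), dodgerPhi (u ^ 2) * dodgerPhi ((Y - u) ^ 2) := by
    refine intervalIntegral.integral_mono_on (by linarith) (by simp) (hi _ _) fun u hu => ?_
    have hu1 : (Y / 4) ^ 2 ≤ u ^ 2 := pow_le_pow_left₀ (by linarith) hu.1 2
    have hu2 : (Y / 4) ^ 2 ≤ (Y - u) ^ 2 := pow_le_pow_left₀ (by linarith) (by linarith [hu.2]) 2
    have e1 : c ≤ dodgerPhi (u ^ 2) :=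
      (dodgerPhiTerm_le_dodgerPhi n (sq_nonneg _)).trans (dodgerPhi_le_dodgerPhi (sq_nonneg _) hu1)
    have e2 : c ≤ dodgerPhi ((Y - u) ^ 2) :=
      (dodgerPhiTerm_le_dodgerPhi n (sq_nonneg _)).trans (dodgerPhi_le_dodgerPhi (sq_nonneg _) hu2)
    rw [sq]
    exact mul_le_mul e1 e2 hc0 (dodgerPhi_pos (sq_nonneg _)).le
  rw [intervalIntegral.integral_const, smul_eq_mul] at hmid
  have e : (3 * Y / 4 - Y / 4) * c ^ 2 = Y / 2 * c ^ 2 := by ring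
  rw [e] at hmid
  linarith

end Summit.RiemannHypothesis.RiemannHypothesis.Theorems.Handoff

end
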